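import Summits.BirchSwinnertonDyer.BirchSwinnertonDyer.Theorems.KatoDescentPotSupersingularWildLowerDesc3Shape
import Literature.NumberTheory.EllipticCurves.SelmerGroupCardinality
import HarnessLib

/-!
# Route `KatoDescentPotSupersingular` (rung K9, cell `bsd-potss`), child crux `WildLowerIntrinsicNonCM`
# (item stmt-BirchSwinnertonDyer-19663), registered stub `stub_intr_red`: the TORSION-AWARE per-class
# road in record SHAPE — «rank `0`, more `3`-Selmer elements than rational `3`-torsion points
# (`#E(ℚ)[3] < #Sel^(3)(E/ℚ)`, the native rank-`0` descent inequality) + `ord₃ #Ш_an ≤ 2` ⇒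
# `MissingLowerBoundAt W 3` at every globally minimal member» (seat `bsd-potss-k9-desc3`, ACCEL row (2)
# of planner bsd-potss-plan g14; a `--supports stmt-BirchSwinnertonDyer-19663 --as helper` file; closes
# NOTHING class-wide)

PARTITION (D-0054, cell bsd-potss): EXCLUDED-DOMAIN non-CM additive `p` · B5 O6 wild `3`, `r_an = 0`,
INTRINSIC classes × X3 (`E[3]` reducible) classes MEETING RATIONAL `3`-TORSION — the rows of
`Sig.stub_intr_red` on which the first shape (`…WildLowerDesc3Shape.lean`, p454413: certificate member
`3`-torsion-free, `3`-torsion-freeness decided by ONE good odd prime `ℓ` with `3 ∤ #Ẽ(𝔽_ℓ)`) has no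
kernel road: when some member of the class has a rational point of order `3`, EVERY member has
`3 ∣ #Ẽ(𝔽_ℓ)` at every good `ℓ` (isogenous curves have equal point counts), so the point-count test
never certifies `3 ∤ #E(ℚ)_tors`, even at the `3`-torsion-free members (census: 62 + 5 of the 152
intrinsic X3 classes `N < 5·10⁵`, k9-c2 `K9-iso3-X3-classes.tsv`). Class-wide the stub is Kato's
Conj. 12.10 (lower half) at the wild prime `3` for reducible `E[3]` — OPEN; nothing here proves it.

WHAT THIS FILE DOES (theorems only; no definition, no named fact, no `sorry`):
* §1 `exists_sha_torsion_of_card_torsionBy_lt_card_selmerGroup` (any number field, any prime `p`):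
  at Mordell–Weil rank `0`, `#E(K)[p] < #Sel^(p)(E/K)` gives a non-zero element of `Ш(E/K)` killed by
  `p` — one line over the tree's PROVED descent count `card_selmerGroup_eq_pow_rank_mul`
  (`#Sel^(n) = n^{rank} · #E(K)[n] · #Ш[n]`, from the PROVED fundamental sequence `selmer_exact_holds`
  and Mordell–Weil): with `rank = 0`, `#Sel^(p) = #E(K)[p] · #Ш[p]`, so the inequality forces
  `#Ш[p] > 1`. No torsion hypothesis: this is the binder-shape a `p`-descent / `p`-isogeny descent
  NATIVELY certifies at rank `0` (`dim Sel^(p) > dim E(ℚ)[p]`), with or without rational `p`-torsion;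
* §2 hence `MissingLowerBoundAt W p` at a rank-`0` pair with `ord_p #Ш_an ≤ 2` (GZK finiteness +
  Cassels–Tate squareness, `missingLowerBoundAt_of_casselsTate_of_pow_dvd`), class-free, and §3 at
  every globally minimal member of the class (Cassels transport), abstract and literal-model forms
  (the literal forms decide `Δ ≠ 0`; global minimality — needed only for the transport — is the record's Kraus term);
* §4 `Sig.stub_intr_red` VERBATIM from one such certificate per class (honest conditional form).

HONEST LABEL: per class a finite certificate road over four PUBLISHED facts by name (Cassels–Tate
`exists_casselsTate_pairing`, Cassels `bsdRHS_eq_of_isIsogenous`, GZK, modularity); the inequality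
`#W₀(ℚ)[3] < #Sel^(3)(W₀/ℚ)` is a binder whose evidence (an explicit `3`-isogeny descent: k9-c2 kit
j250560, `dim Ш(W₀)[φ] ≥ 1`, plus Cremona's `W₀(ℚ)[3]`) lives outside the kernel; BSD is not proved;
the item is NOT closed; nothing is booked here.

References: [SilvermanAEC2009] Thm. X.4.2(a), X.4.14; [Cremona1997] §3.6; [Cassels1965ArithmeticVIII];
[MilneADT2006] Thm. I.7.3; [Miller2011LMS] Def. 1.1; [Kato2004Asterisque] Conj. 12.10 (p. 224).
-/

set_option autoImplicit false
-- sibling precedent (`KatoDescentPotSupersingularAssembly.lean`): the directory name repeats the summit name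
set_option linter.dupNamespace false

noncomputable section

open scoped Classical

namespace Summit.BirchSwinnertonDyer.BirchSwinnertonDyer.Theorems

open WeierstrassCurve Literature.NumberTheory.EllipticCurves
  Literature.NumberTheory.EllipticCurves.Rank1Residual
  Literature.NumberTheory.EllipticCurves.Rank1Residual.Typed
  Literature.NumberTheory.EllipticCurves.Rank1Residual.X11RankOneCertificates
  Summit.BirchSwinnertonDyer.BirchSwinnertonDyer.Rank1Residual.IntModel
  Summit.BirchSwinnertonDyer.Rank1Residual
  Summit.BirchSwinnertonDyer.Rank1Residual.Additive
  Summit.BirchSwinnertonDyer.Rank1Residual.Supersingular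
  Summit.BirchSwinnertonDyer.BirchSwinnertonDyer.Theses.KatoDescentPotSupersingular

/-! ## §1 Rank `0`: more Selmer elements than rational `p`-torsion points ⇒ `Ш[p] ≠ 0` -/

section General

variable {K : Type*} [Field K] [NumberField K] (W : WeierstrassCurve K) [W.IsElliptic]

/-- **Rank-`0` native descent inequality ⇒ `Ш(E/K)[p] ≠ 0`.** For an elliptic curve over a number
field with `rank_ℤ E(K) = 0` and `#E(K)[p] < #Sel^(p)(E/K)`: a non-zero element of `Ш(E/K)` killed by
`p`. By the tree's PROVED descent count `card_selmerGroup_eq_pow_rank_mul`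
(`#Sel^(p) = p^{rank} · #E(K)[p] · #Ш(E/K)[p]`, Silverman X.4.2(a) + Mordell–Weil) the hypothesis
reads `#E(K)[p] < #E(K)[p] · #Ш[p]`, so `#Ш[p] > 1`. No hypothesis on the rational torsion.
[cite: SilvermanAEC2009, Thm. X.4.2(a)] [cite: Cremona1997, §3.6] -/
theorem K9Desc3.exists_sha_torsion_of_card_torsionBy_lt_card_selmerGroup (p : ℕ) [hp : Fact p.Prime]
    (hrank : W.mordellWeilRank = 0)
    (hlt : Nat.card (AddSubgroup.torsionBy W.toAffine.Point p) < Nat.card (W.selmerGroup (p : ℤ))) :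
    ∃ x : W.sha, x ≠ 0 ∧ p • x = 0 := by
  haveI : NeZero p := ⟨hp.out.ne_zero⟩
  set S : AddSubgroup W.galH1 := W.sha ⊓ AddSubgroup.torsionBy W.galH1 (p : ℕ) with hSdef
  have hcount := card_selmerGroup_eq_pow_rank_mul W p
  rw [hrank, pow_zero, one_mul] at hcount
  -- `#Ш[p] > 1`
  have hS1 : 1 < Nat.card S := by
    by_contra hle
    have hle' : Nat.card S ≤ 1 := not_lt.mp hle
    have : Nat.card (W.selmerGroup (p : ℤ)) ≤ Nat.card (AddSubgroup.torsionBy W.toAffine.Point p) := by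
      rw [hcount]
      calc Nat.card (AddSubgroup.torsionBy W.toAffine.Point p) * Nat.card S
          ≤ Nat.card (AddSubgroup.torsionBy W.toAffine.Point p) * 1 := Nat.mul_le_mul_left _ hle'
        _ = _ := mul_one _
    exact absurd hlt (not_lt.mpr this)
  haveI : Finite S := Nat.finite_of_card_ne_zero (by omega)
  haveI : Nontrivial S := Finite.one_lt_card_iff_nontrivial.mp hS1
  obtain ⟨⟨y, hy⟩, hy0⟩ := exists_ne (0 : S)
  refine ⟨⟨y, hy.1⟩, ?_, ?_⟩
  · intro h
    have hy' : y = 0 := congrArg Subtype.val h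
    exact hy0 (Subtype.ext hy')
  · apply Subtype.ext
    simpa only [AddSubgroupClass.coe_nsmul, ZeroMemClass.coe_zero] using
      AddSubgroup.torsionBy.nsmul_iff.mp hy.2

end General

/-! ## §2 The lower half at a rank-`0` pair with `ord_p #Ш_an ≤ 2`, class-free -/

section Pair

variable (W : WeierstrassCurve ℚ) [W.IsElliptic] (p : ℕ) [hp : Fact p.Prime]

/-- **The typed LOWER half from the native rank-`0` descent inequality, class-free.** At a pair with
`ord_{s=1} L(E,s) = 0`, `#Ш(E/ℚ)_an = q` with `ord_p q ≤ 2` and `#E(ℚ)[p] < #Sel^(p)(E/ℚ)`: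
`MissingLowerBoundAt W p`. Chain: rank `0` and `Ш` finite (GZK `hGZK`); §1 ⇒ `Ш[p] ≠ 0` ⇒ `p ∣ #Ш`
(`dvd_shaOrder_of_exists_torsion`) ⇒ `p² ∣ #Ш` by Cassels–Tate squareness (`hCT`,
`missingLowerBoundAt_of_casselsTate_of_pow_dvd`). The twin of
`Supersingular.missingLowerBoundAt_of_casselsTate_of_selmerGroup_ne_bot` WITHOUT the `p ∤ #E(ℚ)_tors`
side condition. No reduction-type or image hypothesis. [cite: SilvermanAEC2009, Thm. X.4.14 and X.4.2(a)]
[cite: Miller2011LMS, §1 and Def. 1.1] -/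
theorem K9Desc3.missingLowerBoundAt_of_casselsTate_of_card_torsionBy_lt_card_selmerGroup
    (hCT : exists_casselsTate_pairing (K := ℚ)) (hGZK : rank_eq_analyticRank_of_analyticRank_le_one)
    (hr : W.analyticRank = 0) {q : ℚ} (hq : shaAn W = (q : ℂ)) (hv : padicValRat p q ≤ 2)
    (hlt : Nat.card (AddSubgroup.torsionBy W.toAffine.Point p) < Nat.card (W.selmerGroup (p : ℤ))) :
    MissingLowerBoundAt W p := by
  have hrank : W.mordellWeilRank = 0 := by
    rw [(hGZK W (by rw [hr]; norm_num)).1, hr]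
  -- the group law on `E(ℚ)` elaborates with the decidable (`ℚ`) resp. classical (general `K`)
  -- equality instance; the two structures agree (`DecidableEq ℚ` is a subsingleton)
  have hdec : (instDecidableEqRat : DecidableEq ℚ) = fun a b => Classical.propDecidable (a = b) :=
    Subsingleton.elim _ _
  rw [hdec] at hlt
  have hex : ∃ x : W.sha, x ≠ 0 ∧ p • x = 0 :=
    K9Desc3.exists_sha_torsion_of_card_torsionBy_lt_card_selmerGroup W p hrank hlt
  exact missingLowerBoundAt_of_casselsTate_of_pow_dvd W p hCT (hGZK W (by rw [hr]; norm_num)).2 hq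
    (k := 1) (by simpa using hv) (by simpa using dvd_shaOrder_of_exists_torsion W p hex)

end Pair

/-! ## §3 … and at every globally minimal member of the class; literal-model forms -/

/-- **`MissingLowerBoundAt W 3` at EVERY globally minimal member `W` of the `ℚ`-isogeny class of a
member `W₀` carrying the rank-`0` descent inequality** (class-free): `W₀` globally minimal of analytic
rank `0`, `#Ш_an(W₀) = s`, `ord₃ s ≤ 2`, `#W₀(ℚ)[3] < #Sel^(3)(W₀/ℚ)` ⇒ the lower half at every
globally minimal `W ∼_ℚ W₀` (§2 at `W₀`, then `TwistComparison.missingLowerBoundAt_of_isIsogenous`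
over Cassels `hCassels` + GZK + modularity `hmod`). Conditional on the four published facts and the
certificate inequality. [cite: MilneADT2006, Thm. I.7.3] [cite: SilvermanAEC2009, Thm. X.4.14]
[cite: Miller2011LMS, §1 and Def. 1.1] -/
theorem K9Desc3.missingLowerBoundAt_three_of_isIsogenous_of_card_torsionBy_lt_card_selmerGroup
    (hCT : exists_casselsTate_pairing (K := ℚ)) (hCassels : bsdRHS_eq_of_isIsogenous)
    (hGZK : rank_eq_analyticRank_of_analyticRank_le_one) (hmod : hasEntireLFunction_rat)
    (W₀ : WeierstrassCurve ℚ) [W₀.IsElliptic] [W₀.IsGloballyMinimal] (hr : W₀.analyticRank = 0)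
    {s : ℚ} (hs : shaAn W₀ = (s : ℂ)) (hv : padicValRat 3 s ≤ 2)
    (hlt : Nat.card (AddSubgroup.torsionBy W₀.toAffine.Point 3) < Nat.card (W₀.selmerGroup (3 : ℤ)))
    (W : WeierstrassCurve ℚ) [W.IsElliptic] [W.IsGloballyMinimal] (hiso : IsIsogenous W W₀) :
    MissingLowerBoundAt W 3 := by
  haveI : Fact (Nat.Prime 3) := ⟨Nat.prime_three⟩
  have hr' : W₀.analyticRank ≤ 1 := by rw [hr]; exact zero_le_one
  exact TwistComparison.missingLowerBoundAt_of_isIsogenous W₀ W 3 hCassels hGZK hmod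
    hiso.symm_of_charZero hr'
    (K9Desc3.missingLowerBoundAt_of_casselsTate_of_card_torsionBy_lt_card_selmerGroup W₀ 3 hCT hGZK hr
      hs hv hlt)

/-- **RECORD SHAPE (torsion-aware) at a literal model.** `W₀ = ⟨a₁,…,a₆⟩` with `Δ ≠ 0` (`h0`,
kernel-decided; the class-free road needs no minimality — `#Ш_an` is read off the model the desk names);
per pair: `r_an = 0` (`hr`), `#Ш_an = s`, `ord₃ s ≤ 2` (`hs`, `hv`), and the descent inequality
`#W₀(ℚ)[3] < #Sel^(3)(W₀/ℚ)` (`hlt`, the certificate line; evidence = Cremona's `W₀(ℚ)[3]` and an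
explicit `3`-(isogeny-)descent) ⇒ `MissingLowerBoundAt W₀ 3`. Per pair; nothing booked.
[cite: SilvermanAEC2009, Thm. X.4.14 and X.4.2(a)] [cite: Miller2011LMS, §1 and Def. 1.1] -/
theorem K9Desc3.missingLowerBoundAt_three_of_ainvs_of_card_torsionBy_lt_card_selmerGroup
    (hCT : exists_casselsTate_pairing (K := ℚ)) (hGZK : rank_eq_analyticRank_of_analyticRank_le_one)
    (a1 a2 a3 a4 a6 : ℤ) (h0 : discOf [a1, a2, a3, a4, a6] ≠ 0)
    (hr : (⟨a1, a2, a3, a4, a6⟩ : WeierstrassCurve ℚ).analyticRank = 0)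
    {s : ℚ} (hs : shaAn (⟨a1, a2, a3, a4, a6⟩ : WeierstrassCurve ℚ) = (s : ℂ))
    (hv : padicValRat 3 s ≤ 2)
    (hlt : Nat.card (AddSubgroup.torsionBy (⟨a1, a2, a3, a4, a6⟩ : WeierstrassCurve ℚ).toAffine.Point 3) <
      Nat.card ((⟨a1, a2, a3, a4, a6⟩ : WeierstrassCurve ℚ).selmerGroup (3 : ℤ))) :
    MissingLowerBoundAt (⟨a1, a2, a3, a4, a6⟩ : WeierstrassCurve ℚ) 3 := by
  haveI := X11b.isElliptic_of_discOf_ne_zero a1 a2 a3 a4 a6 h0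
  haveI : Fact (Nat.Prime 3) := ⟨Nat.prime_three⟩
  exact K9Desc3.missingLowerBoundAt_of_casselsTate_of_card_torsionBy_lt_card_selmerGroup _ 3 hCT hGZK
    hr hs hv hlt

/-- **RECORD SHAPE (torsion-aware) along the class — literal certificate member.** As the previous
theorem plus Cassels `hCassels` and modularity `hmod`: `MissingLowerBoundAt W 3` at every globally
minimal `W ∼_ℚ W₀ = ⟨a₁,…,a₆⟩` (binder `hiso` = the Cremona class datum). Per class; nothing booked.
[cite: MilneADT2006, Thm. I.7.3] [cite: SilvermanAEC2009, Thm. X.4.14 and X.4.2(a)]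
[cite: Miller2011LMS, §1 and Def. 1.1] -/
theorem K9Desc3.missingLowerBoundAt_three_of_isIsogenous_ainvs_of_card_torsionBy_lt_card_selmerGroup
    (hCT : exists_casselsTate_pairing (K := ℚ)) (hCassels : bsdRHS_eq_of_isIsogenous)
    (hGZK : rank_eq_analyticRank_of_analyticRank_le_one) (hmod : hasEntireLFunction_rat)
    (a1 a2 a3 a4 a6 : ℤ) (h0 : discOf [a1, a2, a3, a4, a6] ≠ 0)
    (hmin : (⟨a1, a2, a3, a4, a6⟩ : WeierstrassCurve ℚ).IsGloballyMinimal)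
    (hr : (⟨a1, a2, a3, a4, a6⟩ : WeierstrassCurve ℚ).analyticRank = 0)
    {s : ℚ} (hs : shaAn (⟨a1, a2, a3, a4, a6⟩ : WeierstrassCurve ℚ) = (s : ℂ))
    (hv : padicValRat 3 s ≤ 2)
    (hlt : Nat.card (AddSubgroup.torsionBy (⟨a1, a2, a3, a4, a6⟩ : WeierstrassCurve ℚ).toAffine.Point 3) <
      Nat.card ((⟨a1, a2, a3, a4, a6⟩ : WeierstrassCurve ℚ).selmerGroup (3 : ℤ)))
    (W : WeierstrassCurve ℚ) [W.IsElliptic] [W.IsGloballyMinimal]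
    (hiso : IsIsogenous W (⟨a1, a2, a3, a4, a6⟩ : WeierstrassCurve ℚ)) :
    MissingLowerBoundAt W 3 := by
  haveI := X11b.isElliptic_of_discOf_ne_zero a1 a2 a3 a4 a6 h0
  haveI := hmin
  exact K9Desc3.missingLowerBoundAt_three_of_isIsogenous_of_card_torsionBy_lt_card_selmerGroup hCT
    hCassels hGZK hmod _ hr hs hv hlt W hiso

/-! ## §4 The registered stub `stub_intr_red` VERBATIM from one descent inequality per class -/

/-- **`Sig.stub_intr_red` (birth skeleton of 19663, VERBATIM conclusion) from the four published facts
and ONE RANK-`0` DESCENT INEQUALITY PER CLASS.** `hwit`: every intrinsic non-CM reducible-mod-`3` wild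
rank-`0` row `W` has, in its `ℚ`-isogeny class, a globally minimal member `W₀` of analytic rank `0`
with `ord₃ #Ш_an(W₀) ≤ 2` and `#W₀(ℚ)[3] < #Sel^(3)(W₀/ℚ)` (the per-class certificate slot; census
k9-c2 j250560: a member with `ord₃ #Ш_an = 2` and `dim Ш[φ] ≥ 1` or `dim Ш[φ̂] ≥ 1` on 123 of the
152 intrinsic X3 classes `N < 5·10⁵`; the 29 mirror classes need a second descent). HONEST LABEL: a
per-class road made uniform by hypothesis — class-wide `hwit` is the stub's own content (open);
conditional; the item is NOT closed. [cite: Kato2004Asterisque, Conj. 12.10 (p. 224)]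
[cite: SilvermanAEC2009, Thm. X.4.14 and X.4.2(a)] [cite: MilneADT2006, Thm. I.7.3]
[cite: Miller2011LMS, §1 and Def. 1.1] -/
theorem K9Desc3.stub_intr_red_of_descentInequalities
    (hCT : exists_casselsTate_pairing (K := ℚ)) (hCassels : bsdRHS_eq_of_isIsogenous)
    (hGZK : rank_eq_analyticRank_of_analyticRank_le_one) (hmod : hasEntireLFunction_rat)
    (hwit : ∀ (W : WeierstrassCurve ℚ) [W.IsElliptic] [W.IsGloballyMinimal] [Fact (3 : ℕ).Prime],
      W.analyticRank = 0 → ClassO6 W 3 → ¬ Irr W 3 → ¬ W.HasCM →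
      (∀ (W' : WeierstrassCurve ℚ) [W'.IsElliptic] [W'.IsGloballyMinimal], IsIsogenous W W' →
        ∀ q' : ℚ, shaAn W' = (q' : ℂ) → 0 < padicValRat 3 q') →
      ∃ (W₀ : WeierstrassCurve ℚ) (_ : W₀.IsElliptic) (_ : W₀.IsGloballyMinimal),
        IsIsogenous W W₀ ∧ W₀.analyticRank = 0 ∧
        ∃ s : ℚ, shaAn W₀ = (s : ℂ) ∧ padicValRat 3 s ≤ 2 ∧
          Nat.card (AddSubgroup.torsionBy W₀.toAffine.Point 3) < Nat.card (W₀.selmerGroup (3 : ℤ))) :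
    ∀ (W : WeierstrassCurve ℚ) [W.IsElliptic] [W.IsGloballyMinimal] [Fact (3 : ℕ).Prime],
      W.analyticRank = 0 → ClassO6 W 3 → ¬ Irr W 3 → ¬ W.HasCM →
      (∀ (W' : WeierstrassCurve ℚ) [W'.IsElliptic] [W'.IsGloballyMinimal], IsIsogenous W W' →
        ∀ q' : ℚ, shaAn W' = (q' : ℂ) → 0 < padicValRat 3 q') →
      MissingLowerBoundAt W 3 := by
  intro W _ _ _ hr hO hred hCM hI
  obtain ⟨W₀, hE₀, hM₀, hiso, hr₀, s, hs, hv, hlt⟩ := hwit W hr hO hred hCM hI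
  haveI := hE₀
  haveI := hM₀
  exact K9Desc3.missingLowerBoundAt_three_of_isIsogenous_of_card_torsionBy_lt_card_selmerGroup hCT
    hCassels hGZK hmod W₀ hr₀ hs hv hlt W hiso

end Summit.BirchSwinnertonDyer.BirchSwinnertonDyer.Theorems

end
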